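/-
COR-CM (cell pub-hodgecm2, stage 2 of the Hodge ladder) — count-neutral KERNEL SYMMETRY of the face-form period theorem
`Universe.PeriodThmF` (= `PerLFace`) and of the displayed B01 leaves B01-C `FaceSeesawCoupling` / B01-O `FaceWedgeOverlap`
(`CorCM/B01/FaceSkeleton.lean`, `CorCM/B01/FaceInputsSplit.lean`): the DUAL FACE, part 1 of 2 (part 2 = `CorCM/FaceOrientedOverlap.lean`,
the leaves at one orientation per square).  Seat prover-pub-hodgecm2-b07-g32-0 (binder prover b07, gen 32; claim FACE-DUAL,
HOME/lit/LIT-STATUS.md 2026-08-21T08:45Z).  One support definition (`Face.dual`), theorems; no named fact, nothing asserted; nothing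
under `CorCM/B01/` is edited (its declarations are imported BY NAME); `Interfaces.lean` (C1) untouched.
-/
import Summits.HodgeConjecture.CorCM.B01.HodgeRiemannPeriod
import Summits.HodgeConjecture.CorCM.B01.FaceSkeleton
import Summits.HodgeConjecture.CorCM.B01.InducedPeriodType
import Summits.HodgeConjecture.CorCM.Proofs.Prop22.Multilinear
import Summits.HodgeConjecture.CorCM.Model.ModelAxiomsHolds
import HarnessLib

/-!
# The dual face: the (12)|(34) partition is the pair of diagonals of the type square, and the period is
# orientation-symmetric

A rank-four face `f = (Φ; π, π′)` has period types `ψ = (Φ, Φ^{(ππ′)}, Φ^{(π)}, Φ^{(π′)})` (`Face.psi`): the (12)-pair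
`{ψ₀, ψ₁} = {Φ, Φ^{(ππ′)}}` and the (34)-pair `{ψ₂, ψ₃} = {Φ^{(π)}, Φ^{(π′)}}` are the two DIAGONALS of the square
`{Φ, Φ^{(π)}, Φ^{(π′)}, Φ^{(ππ′)}}` of types obtained from `Φ` by flips at `π`, `π′`.  Every face on this square (base corner any of the
four, places `π, π′` in either order) induces the SAME partition into diagonals; the only datum that changes is WHICH diagonal is
integrated unconjugated (slots 1, 2 of the period `∫ ω₀ ∧ ω₁ ∧ \overline{ω₂ ∧ ω₃}`) and which conjugated.

1. `Face.dual f := (Φ^{(π)}; π, π′)` — the face on the same square with the diagonals exchanged: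
   `f.dual.psi = (ψ₂, ψ₃, ψ₀, ψ₁) = f.psi ∘ ![2, 3, 0, 1]` (`Face.dual_psi_eq_comp`, from `flip_flip`), `f.dual.dual = f`, and
   `ι₁` is admissible for `f.dual` iff it is for `f` (flipping at a place other than that of `ι₁` does not move `ι₁`).
2. `Universe.period_dual` — on ANY universe with graded commutativity in degree one and the interchange law
   (`Fact_cup_comm1`, `Fact_cup_interchange`; rows M19/M20 of `ModelAxioms`, theorems on the model universe):
   `U.period X ![ω 2, ω 3, ω 0, ω 1] = conj (U.period X ω)` — exchanging the unconjugated and the conjugated pair conjugates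
   the period (`conj` is multiplicative on cup products and commutes with the trace; two degree-two classes commute).  Hence
   `Universe.periodNV_comp_swapPairs_iff` and **`Universe.periodNV_face_dual_iff`**:
   `U.PeriodNV ι₁ V F f.dual.psi σ ↔ U.PeriodNV ι₁ V F f.psi σ`.
3. ORIENTATION REDUCTION.  For any selector `π` of faces with `π f ∨ π f.dual` for every `f`, `PeriodThmF` follows from its
   restriction to the selected faces (`Universe.periodThmF_of_oriented`, `Model.perLFace_of_oriented`).  The sequel
   `CorCM/FaceOrientedOverlap.lean` draws the consequence for the displayed leaves: B01-C `FaceSeesawCoupling` / B01-O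
   `FaceWedgeOverlap` are needed at ONE orientation per square.
4. Degree 6 (`Face.sq_stable_slot_lt_two_or_dual`, from own-b01's `Face.psi_exists_sq_stable`): at a Galois sextic field one may
   select the orientation in which a `σ²`-STABLE period type — the one induced from the imaginary quadratic subfield
   (`Face.psi_exists_eq_inducedCMType`), whose `A_{(F,ψ)}` is isogenous to the cube of a CM elliptic curve — sits on the
   UNconjugated diagonal `{ψ₀, ψ₁}`.

Nothing displayed changes; whether B01-C / B01-O are re-cut per square is the call of the owner of `CorCM/B01/`.

References: rfwf v3 Def. 1.1 / §4.2 (faces and their period types; the eigencharacter bookkeeping of Prop. 2.2); PerL v5 Thm 4.4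
(the period `∫ F₁^*α₁ ∧ F₂^*α₂ ∧ \overline{F₃^*α₃ ∧ F₄^*α₄}`); P. Deligne, *Théorie de Hodge II*, 2.1.4 (the real structure
`conj ⊗ id` on a complexified rational Hodge structure); A. Hatcher, *Algebraic Topology* (2002) §3.2 Thm. 3.11 (graded
commutativity of the cup product).
-/

noncomputable section

open scoped TensorProduct
open NumberField
open Literature.AlgebraicGeometry.Motives (CMType HodgeStructure)
open Literature.AlgebraicGeometry.Motives.HodgeStructure (conj)
open Literature.NumberTheory.ComplexMultiplication.CMTypeOps
open Literature.AlgebraicGeometry.HodgeTheory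
open Literature.NumberTheory.Automorphic.PicardCM
open Literature.NumberTheory.Automorphic.PicardCM.CMCode (cmTypeMap)

namespace Summit.HodgeConjecture.CorCM

/-! ## §1  The dual face -/

/-- Flipping a CM type at the place of `p` does not change membership of an embedding `φ` off that place. -/
theorem mem_flip_iff_of_not_mem_placeSet {K : Type} [Field K] {p φ : K →+* ℂ} (h : φ ∉ placeSet p)
    (Φ : CMType K) : φ ∈ (flip p Φ).1 ↔ φ ∈ Φ.1 := by
  rw [mem_flip_iff]
  tauto

namespace Face

variable {K : Type} [Field K]

/-- **The dual face** `f^∨ = (Φ^{(π)}; π, π′)` of `f = (Φ; π, π′)`: same places, base corner moved along the edge `π` of the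
type square.  Its period types are those of `f` with the (12)- and (34)-pairs exchanged (`dual_psi_eq_comp`). -/
def dual (f : Face K) : Face K where
  Φ := flip f.p f.Φ
  p := f.p
  p' := f.p'
  place_ne := f.place_ne

/-- The base type of the dual face is `Φ^{(π)}`. -/
@[simp] theorem dual_Φ (f : Face K) : f.dual.Φ = flip f.p f.Φ := rfl

/-- The dual face has the same first place. -/
@[simp] theorem dual_p (f : Face K) : f.dual.p = f.p := rfl

/-- The dual face has the same second place. -/
@[simp] theorem dual_p' (f : Face K) : f.dual.p' = f.p' := rfl

/-- `ψ₀(f^∨) = Φ^{(π)} = ψ₂(f)`. -/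
theorem dual_psi_zero (f : Face K) : f.dual.psi 0 = f.psi 2 := rfl

/-- `ψ₁(f^∨) = (Φ^{(π)})^{(ππ′)} = Φ^{(π′)} = ψ₃(f)`. -/
theorem dual_psi_one (f : Face K) : f.dual.psi 1 = f.psi 3 := by
  show flip f.p' (flip f.p (flip f.p f.Φ)) = flip f.p' f.Φ
  rw [Literature.NumberTheory.ComplexMultiplication.CMTypeOps.flip_flip]

/-- `ψ₂(f^∨) = (Φ^{(π)})^{(π)} = Φ = ψ₀(f)`. -/
theorem dual_psi_two (f : Face K) : f.dual.psi 2 = f.psi 0 := by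
  show flip f.p (flip f.p f.Φ) = f.Φ
  rw [Literature.NumberTheory.ComplexMultiplication.CMTypeOps.flip_flip]

/-- `ψ₃(f^∨) = (Φ^{(π)})^{(π′)} = Φ^{(ππ′)} = ψ₁(f)`. -/
theorem dual_psi_three (f : Face K) : f.dual.psi 3 = f.psi 1 := rfl

/-- **The period types of the dual face are those of the face with the two pairs exchanged**:
`f.dual.psi = f.psi ∘ (0 1 2 3 ↦ 2 3 0 1)`. -/
theorem dual_psi_eq_comp (f : Face K) : f.dual.psi = f.psi ∘ ![2, 3, 0, 1] := by
  funext i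
  fin_cases i
  · rfl
  · exact f.dual_psi_one
  · exact f.dual_psi_two
  · rfl

/-- Duality is an involution: `(f^∨)^∨ = f`. -/
theorem dual_dual (f : Face K) : f.dual.dual = f := by
  cases f with
  | mk Φ p p' h =>
    simp only [dual, Literature.NumberTheory.ComplexMultiplication.CMTypeOps.flip_flip]

/-- The unordered pair `{ψ₀, ψ₁}` of the dual face is the pair `{ψ₂, ψ₃}` of the face, and conversely: both faces partition
the same four types into the same two (diagonal) pairs. -/
theorem dual_psi_pairs (f : Face K) :
    ({f.dual.psi 0, f.dual.psi 1} : Set (CMType K)) = {f.psi 2, f.psi 3} ∧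
      ({f.dual.psi 2, f.dual.psi 3} : Set (CMType K)) = {f.psi 0, f.psi 1} := by
  rw [dual_psi_zero, dual_psi_one, dual_psi_two, dual_psi_three]
  exact ⟨rfl, rfl⟩

/-- **Admissibility is orientation-free**: `ι₁` is admissible for `f^∨` iff it is admissible for `f` (the place of `ι₁` is
neither `π` nor `π′`, so the flip at `π` does not move `ι₁`). -/
theorem dual_admissible_iff (f : Face K) (ι₁ : K →+* ℂ) : f.dual.Admissible ι₁ ↔ f.Admissible ι₁ := by
  simp only [Face.Admissible, dual_p, dual_p', dual_Φ]
  constructor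
  · rintro ⟨h0, h1, h2⟩
    exact ⟨(mem_flip_iff_of_not_mem_placeSet (fun hx => h1 (mk_eq_of_mem_placeSet hx)) f.Φ).1 h0, h1, h2⟩
  · rintro ⟨h0, h1, h2⟩
    exact ⟨(mem_flip_iff_of_not_mem_placeSet (fun hx => h1 (mk_eq_of_mem_placeSet hx)) f.Φ).2 h0, h1, h2⟩

/-- **Degree 6: a `σ²`-stable period type can be put on the unconjugated diagonal.**  For a face `f` of a Galois sextic CM
field, either `f` or `f^∨` has a `σ²`-stable period type (the one induced from the imaginary quadratic subfield,
`psi_exists_eq_inducedCMType`) in a (12)-slot `i < 2` (from own-b01's `psi_exists_sq_stable` and `dual_psi_*`). [folklore] -/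
theorem sq_stable_slot_lt_two_or_dual {K : Type} [Field K] [NumberField K] [IsCMField K] [IsGalois ℚ K]
    (h6 : Module.finrank ℚ K = 6) (f : Face K) :
    (∃ (σ : K ≃ₐ[ℚ] K) (i : Fin 4), i.val < 2 ∧ orderOf σ = 6 ∧ cmTypeMap (σ ^ 2).toRingEquiv (f.psi i) = f.psi i) ∨
      (∃ (σ : K ≃ₐ[ℚ] K) (i : Fin 4), i.val < 2 ∧ orderOf σ = 6 ∧
        cmTypeMap (σ ^ 2).toRingEquiv (f.dual.psi i) = f.dual.psi i) := by
  obtain ⟨σ, i, hσ, hst⟩ := psi_exists_sq_stable h6 f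
  fin_cases i
  · exact Or.inl ⟨σ, 0, by decide, hσ, hst⟩
  · exact Or.inl ⟨σ, 1, by decide, hσ, hst⟩
  · exact Or.inr ⟨σ, 0, by decide, hσ, by rw [dual_psi_zero]; exact hst⟩
  · exact Or.inr ⟨σ, 1, by decide, hσ, by rw [dual_psi_one]; exact hst⟩

end Face

/-! ## §2  The period of the exchanged quadruple is the conjugate period -/

namespace Universe

variable {U : Universe}

/-- The complexified trace commutes with complex conjugation: `tr(conj x) = conj (tr x)` (`tr` is defined over `ℚ`). -/
theorem trC_conj (X : U.Var) (k : ℕ) (x : U.CohC X k) : U.trC X k (conj x) = starRingEnd ℂ (U.trC X k x) := by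
  induction x using TensorProduct.induction_on with
  | zero => simp
  | add a b ha hb => simp only [map_add, ha, hb]
  | tmul z a =>
    rw [HodgeStructure.conj_tmul, trC_tmul, trC_tmul, Rat.smul_def, Rat.smul_def, map_mul, map_ratCast]

/-- Complex conjugation is multiplicative on the four-fold cup product:
`conj ((a ∪ b) ∪ (c ∪ d)) = (conj a ∪ conj b) ∪ (conj c ∪ conj d)`. -/
theorem conj_quadC (X : U.Var) (a b c d : U.CohC X 1) :
    conj (U.quadC X a b c d) = U.quadC X (conj a) (conj b) (conj c) (conj d) := by
  unfold Universe.quadC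
  have h := conj_cup2C X 2 (U.cup2C X 1 a b) (U.cup2C X 1 c d)
  rw [conj_cup2C X 1 a b, conj_cup2C X 1 c d] at h
  exact h

/-- **Two degree-two wedges commute**: `(a ∪ b) ∪ (c ∪ d) = (c ∪ d) ∪ (a ∪ b)` for degree-one classes (graded commutativity
in degree one and the interchange law, `Fact_cup_comm1` + `Fact_cup_interchange`). -/
theorem quadC_swap_pairs (h1 : U.Fact_cup_comm1) (h2 : U.Fact_cup_interchange) (X : U.Var) (a b c d : U.CohC X 1) :
    U.quadC X a b c d = U.quadC X c d a b := by
  rw [quadC_swap12 h2 X a b c d, quadC_swap01 h1 X a c b d, neg_neg, quadC_swap23 h1 X c a b d,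
    quadC_swap12 h2 X c a d b, neg_neg]

/-- **Period duality**: exchanging the unconjugated pair `(ω₀, ω₁)` with the conjugated pair `(ω₂, ω₃)` conjugates the period,
`∫ ω₂ ∧ ω₃ ∧ \overline{ω₀ ∧ ω₁} = \overline{∫ ω₀ ∧ ω₁ ∧ \overline{ω₂ ∧ ω₃}}` (any universe with `Fact_cup_comm1`,
`Fact_cup_interchange`). -/
theorem period_dual (h1 : U.Fact_cup_comm1) (h2 : U.Fact_cup_interchange) (X : U.Var) (ω : Fin 4 → U.CohC X 1) :
    U.period X ![ω 2, ω 3, ω 0, ω 1] = starRingEnd ℂ (U.period X ω) := by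
  simp only [Universe.period, Matrix.cons_val_zero, Matrix.cons_val_one, Matrix.cons_val]
  rw [← trC_conj, conj_quadC, HodgeStructure.conj_conj, HodgeStructure.conj_conj,
    quadC_swap_pairs h1 h2 X (ω 2) (ω 3) (conj (ω 0)) (conj (ω 1))]

/-- The exchanged period is non-zero iff the period is. -/
theorem period_dual_ne_zero_iff (h1 : U.Fact_cup_comm1) (h2 : U.Fact_cup_interchange) (X : U.Var)
    (ω : Fin 4 → U.CohC X 1) : U.period X ![ω 2, ω 3, ω 0, ω 1] ≠ 0 ↔ U.period X ω ≠ 0 := by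
  rw [period_dual h1 h2, map_ne_zero_iff _ (RingHom.injective _)]

/-! ## §3  `PeriodNV` and `PeriodThmF` are orientation-symmetric -/

/-- **`PeriodNV` for the exchanged quadruple of types** `(Ψ₂, Ψ₃, Ψ₀, Ψ₁)` from `PeriodNV` for `Ψ`: same level, morphisms and
one-forms permuted, period conjugated (`period_dual`). -/
theorem periodNV_comp_swapPairs (h1 : U.Fact_cup_comm1) (h2 : U.Fact_cup_interchange) {L : CMField} {ι₁ : L →+* ℂ}
    {V : HermSpace3 L ι₁} (K : CMField) (Ψ : Fin 4 → CMType K) (σ : K →+* ℂ) (h : U.PeriodNV ι₁ V K Ψ σ) :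
    U.PeriodNV ι₁ V K (Ψ ∘ ![2, 3, 0, 1]) σ := by
  obtain ⟨Γ, F, α, hα, hper⟩ := h
  refine ⟨Γ, fun i => F ((![2, 3, 0, 1] : Fin 4 → Fin 4) i), fun i => α ((![2, 3, 0, 1] : Fin 4 → Fin 4) i),
    fun i => hα _, ?_⟩
  have hω : (fun i => U.pullC (F ((![2, 3, 0, 1] : Fin 4 → Fin 4) i)) 1 (α ((![2, 3, 0, 1] : Fin 4 → Fin 4) i))) =
      ![U.pullC (F 2) 1 (α 2), U.pullC (F 3) 1 (α 3), U.pullC (F 0) 1 (α 0), U.pullC (F 1) 1 (α 1)] := by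
    funext i
    fin_cases i <;> rfl
  show U.period _ (fun i => U.pullC (F ((![2, 3, 0, 1] : Fin 4 → Fin 4) i)) 1
    (α ((![2, 3, 0, 1] : Fin 4 → Fin 4) i))) ≠ 0
  rw [hω]
  exact (period_dual_ne_zero_iff h1 h2 _ (fun i => U.pullC (F i) 1 (α i))).2 hper

/-- The pair exchange `(0 1 2 3 ↦ 2 3 0 1)` is an involution of `Fin 4`. -/
theorem swapPairs_comp_swapPairs :
    ((![2, 3, 0, 1] : Fin 4 → Fin 4) ∘ (![2, 3, 0, 1] : Fin 4 → Fin 4)) = id := by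
  funext i
  fin_cases i <;> rfl

/-- **`PeriodNV` is orientation-symmetric**: `PeriodNV` for `(Ψ₂, Ψ₃, Ψ₀, Ψ₁)` iff `PeriodNV` for `Ψ`. -/
theorem periodNV_comp_swapPairs_iff (h1 : U.Fact_cup_comm1) (h2 : U.Fact_cup_interchange) {L : CMField} {ι₁ : L →+* ℂ}
    {V : HermSpace3 L ι₁} (K : CMField) (Ψ : Fin 4 → CMType K) (σ : K →+* ℂ) :
    U.PeriodNV ι₁ V K (Ψ ∘ ![2, 3, 0, 1]) σ ↔ U.PeriodNV ι₁ V K Ψ σ := by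
  refine ⟨fun h => ?_, periodNV_comp_swapPairs h1 h2 K Ψ σ⟩
  have h' := periodNV_comp_swapPairs h1 h2 K (Ψ ∘ ![2, 3, 0, 1]) σ h
  rwa [Function.comp_assoc, swapPairs_comp_swapPairs, Function.comp_id] at h'

/-- **The face-form period statement is orientation-symmetric**: `PeriodNV` for the dual face `f^∨` iff `PeriodNV` for `f`
(any universe with `Fact_cup_comm1`, `Fact_cup_interchange`). -/
theorem periodNV_face_dual_iff (h1 : U.Fact_cup_comm1) (h2 : U.Fact_cup_interchange) {F : CMField} (f : Face F)
    {ι₁ : F →+* ℂ} (V : HermSpace3 F ι₁) (σ : F →+* ℂ) :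
    U.PeriodNV ι₁ V F f.dual.psi σ ↔ U.PeriodNV ι₁ V F f.psi σ := by
  rw [Face.dual_psi_eq_comp]
  exact periodNV_comp_swapPairs_iff h1 h2 F f.psi σ

/-- **Orientation reduction for `PeriodThmF`.**  Let `π` select, on every square, at least one of the two orientations
(`π f ∨ π f.dual` for every face `f`).  If the period theorem holds at the selected faces, it holds at all faces
(`periodNV_face_dual_iff`, `Face.dual_admissible_iff`). -/
theorem periodThmF_of_oriented (h1 : U.Fact_cup_comm1) (h2 : U.Fact_cup_interchange)
    (π : ∀ ⦃F : CMField⦄, Face F → Prop) (hπ : ∀ ⦃F : CMField⦄ (f : Face F), π f ∨ π f.dual)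
    (h : ∀ (F : CMField), IsGalois ℚ F → 6 ≤ Module.finrank ℚ F → ∀ (f : Face F), π f →
      ∀ (ι₁ : F →+* ℂ), f.Admissible ι₁ → ∀ V : HermSpace3 F ι₁, U.PeriodNV ι₁ V F f.psi ι₁) :
    U.PeriodThmF := by
  intro F hG h6 f ι₁ hι V
  rcases hπ f with hf | hf
  · exact h F hG h6 f hf ι₁ hι V
  · exact (periodNV_face_dual_iff h1 h2 f V ι₁).1 (h F hG h6 f.dual hf ι₁ ((Face.dual_admissible_iff f ι₁).2 hι) V)

/-- `PeriodThmF` restricted to any family of faces (the trivial direction). -/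
theorem periodNV_of_periodThmF (h : U.PeriodThmF) (F : CMField) (hG : IsGalois ℚ F) (h6 : 6 ≤ Module.finrank ℚ F)
    (f : Face F) (ι₁ : F →+* ℂ) (hι : f.Admissible ι₁) (V : HermSpace3 F ι₁) : U.PeriodNV ι₁ V F f.psi ι₁ :=
  h F hG h6 f ι₁ hι V

end Universe

/-! ## §4  The model universe: the cup-product rows are theorems -/

namespace Model


/-- **`PeriodNV` is orientation-symmetric on the model universe** `universeOf hHD hI hU h₃` (rows M19 `cup_comm1`, M20
`cup_interchange` of `modelAxioms_holds`). -/
theorem universeOf_periodNV_face_dual_iff (hHD : exists_isReal_hodgeModel) (hI : hodgePQ_independent_of_hodgeModel)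
    (hU : BallQuotientUniformisedDatum) (h₃ : CMAbelianVarietyRealised) {F : CMField} (f : Face F) {ι₁ : F →+* ℂ}
    (V : HermSpace3 F ι₁) (σ : F →+* ℂ) :
    (universeOf hHD hI hU h₃).PeriodNV ι₁ V F f.dual.psi σ ↔ (universeOf hHD hI hU h₃).PeriodNV ι₁ V F f.psi σ :=
  Universe.periodNV_face_dual_iff (modelAxioms_holds hHD hI hU h₃).cup_comm1 (modelAxioms_holds hHD hI hU h₃).cup_interchange
    f V σ

/-- **`PeriodNV` is orientation-symmetric on the universe of record** `picardCMUniverse hHD hI h₁ h₃`. -/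
theorem periodNV_face_dual_iff (hHD : exists_isReal_hodgeModel) (hI : hodgePQ_independent_of_hodgeModel)
    (h₁ : BallQuotientUniformised) (h₃ : CMAbelianVarietyRealised) {F : CMField} (f : Face F) {ι₁ : F →+* ℂ}
    (V : HermSpace3 F ι₁) (σ : F →+* ℂ) :
    (picardCMUniverse hHD hI h₁ h₃).PeriodNV ι₁ V F f.dual.psi σ ↔ (picardCMUniverse hHD hI h₁ h₃).PeriodNV ι₁ V F f.psi σ :=
  universeOf_periodNV_face_dual_iff hHD hI _ h₃ f V σ

/-- **`PerLFace` of the universe of record from its restriction to selected faces** (`π f ∨ π f.dual`). -/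
theorem perLFace_of_oriented (hHD : exists_isReal_hodgeModel) (hI : hodgePQ_independent_of_hodgeModel)
    (h₁ : BallQuotientUniformised) (h₃ : CMAbelianVarietyRealised)
    (π : ∀ ⦃F : CMField⦄, Face F → Prop) (hπ : ∀ ⦃F : CMField⦄ (f : Face F), π f ∨ π f.dual)
    (h : ∀ (F : CMField), IsGalois ℚ F → 6 ≤ Module.finrank ℚ F → ∀ (f : Face F), π f →
      ∀ (ι₁ : F →+* ℂ), f.Admissible ι₁ → ∀ V : HermSpace3 F ι₁, (picardCMUniverse hHD hI h₁ h₃).PeriodNV ι₁ V F f.psi ι₁) :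
    (picardCMUniverse hHD hI h₁ h₃).PerLFace :=
  Universe.periodThmF_of_oriented (picardCMUniverse_modelAxioms hHD hI h₁ h₃).cup_comm1
    (picardCMUniverse_modelAxioms hHD hI h₁ h₃).cup_interchange π hπ h

end Model

end Summit.HodgeConjecture.CorCM

end
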